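import Summits.Ventures.LatticeQCDFlow.TrivializingMaps.UNHaarTraceMoments
import HarnessLib

/-!
# Fourth moments of the entries of a Haar unitary: `∫_{U(N)} |U_ip|⁴ = 2/(N(N+1))`, `∫ |U_ip|²|U_iq|² = 1/(N(N+1))`, `∫ |U_ii|²|U_jj|² = 1/(N²−1)`

HONEST FRAMING: exact (Metropolis-corrected) sampling algorithms for lattice gauge theory;
figures of merit are autocorrelation/cost numbers at stated couplings and volumes; no
continuum-physics claim.

Venture `LatticeQCDFlow` (cell pub-lqcd), sub-topic `Scoring`; FANOUT row 5 (`s0-sun-a`), GEN-20.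
NEW WORK of the cell (placement rule).  Sequel of `TrivializingMaps.UNHaarTraceMoments` (second moments
`∫ |U_ij|² = 1/N`, `∫ |tr U|² = 1`, by one-sided Haar invariance under signed transpositions and diagonal
circles).  Here the FOURTH moments of the entries of a Haar-distributed `U ∈ U(N)`, every `N ≥ 2`, by the
same elementary method plus ONE genuinely mixing element `u = ((1+i)/2)·1 + ((1−i)/2)·swap(p,q) ∈ U(N)`:

* §1 one-sided invariances: `∫ |U_ip|⁴ = ∫ |U_iq|⁴`, `∫ |U_ip|²|U_iq|² = ∫ |U_ip|²|U_iq′|²` (right signed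
  transpositions), the phase kills `∫ (|U_ip|²+|U_iq|²)·U_ip·conj(U_iq) = 0`, `∫ U_ip²·conj(U_iq)² = 0` (right
  diagonal circles), and the MIXING RELATION `∫ |U_ip|⁴ = 2 ∫ |U_ip|²|U_iq|²` (right multiplication by `u`);
* §2 **`∫_{U(N)} |U_ip|⁴ dU = 2/(N(N+1))`** and **`∫ |U_ip|²|U_iq|² dU = 1/(N(N+1))`** (`p ≠ q`; with the row
  normalisation `Σ_q |U_iq|² = 1`): the squared moduli of a row are uniform on the simplex;
* §3 **`∫ |U_ii|²|U_jj|² dU = 1/(N² − 1)`** (`i ≠ j`; left signed transpositions and the column normalisation).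

These are the degree-4 Weingarten values `Wg(1_2) = 1/(N²−1)`, `Wg((12)) = −1/(N(N²−1))` in disguise
(`2/(N(N+1)) = 2(Wg(1_2)+Wg((12)))`); they feed the fourth trace moment `∫ |tr U|⁴ = 2` of the sequel
`UNHaarTraceFourthMoment`.  No `def`, nothing cited as a fact, 0 sorry.
-/

noncomputable section

open Real MeasureTheory Filter Topology Finset Complex
open Literature.MathematicalPhysics.QuantumFieldTheory
open Literature.MathematicalPhysics.QuantumLattice

namespace Summit.Ventures.LatticeQCDFlow.Scoring

variable {N : ℕ}

open Summit.Ventures.LatticeQCDFlow.TrivializingMaps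

/-! ## §1 One-sided invariances of the degree-4 entry moments -/

/-- Right multiplication by the signed transposition `sSwap a b` (`a ≠ b`) moves column `b` to column `a`
and fixes every column `p ∉ {a, b}`. -/
theorem mul_sSwapMatrix_apply (U : Matrix (Fin N) (Fin N) ℂ) {a b : Fin N} (hab : a ≠ b) (i : Fin N) :
    (U * sSwapMatrix a b) i a = U i b ∧ ∀ p, p ≠ a → p ≠ b → (U * sSwapMatrix a b) i p = U i p := by
  unfold sSwapMatrix
  rw [if_neg hab, ← mul_assoc]
  refine ⟨?_, fun p hpa hpb => ?_⟩
  · rw [Matrix.mul_swap_apply_left, Matrix.mul_diagonal, Function.update_of_ne (Ne.symm hab), Pi.one_apply, mul_one]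
  · rw [Matrix.mul_swap_of_ne hpa hpb, Matrix.mul_diagonal, Function.update_of_ne hpa, Pi.one_apply, mul_one]

/-- Left multiplication by `sSwap a b` (`a ≠ b`) moves row `a` to row `b` and fixes every row `i ∉ {a, b}`. -/
theorem sSwapMatrix_mul_apply (U : Matrix (Fin N) (Fin N) ℂ) {a b : Fin N} (hab : a ≠ b) (q : Fin N) :
    (sSwapMatrix a b * U) b q = U a q ∧ ∀ i, i ≠ a → i ≠ b → (sSwapMatrix a b * U) i q = U i q := by
  unfold sSwapMatrix
  rw [if_neg hab, mul_assoc]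
  refine ⟨?_, fun i hia hib => ?_⟩
  · rw [Matrix.diagonal_mul, Matrix.swap_mul_apply_right, Function.update_of_ne (Ne.symm hab), Pi.one_apply, one_mul]
  · rw [Matrix.diagonal_mul, Matrix.swap_mul_of_ne hia hib, Function.update_of_ne hia, Pi.one_apply, one_mul]

/-- A real continuous function of the matrix entries is Haar-integrable on `U(N)` (bundled form used below). -/
theorem integrable_haarUN_real_of_continuous_matrix {F : Matrix (Fin N) (Fin N) ℂ → ℝ} (hF : Continuous F) :
    Integrable (fun U : Matrix.unitaryGroup (Fin N) ℂ => F (U : Matrix (Fin N) (Fin N) ℂ)) (haarProbability (Matrix.unitaryGroup (Fin N) ℂ)) :=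
  integrable_haarUN_of_continuous_real (hF.comp continuous_subtype_val)

/-- **Right invariance, packaged**: for `S ∈ U(N)`, `∫ F(U·S) dU = ∫ F(U) dU`. -/
theorem un_integral_mul_right (F : Matrix (Fin N) (Fin N) ℂ → ℝ) (S : Matrix.unitaryGroup (Fin N) ℂ) :
    ∫ U, F ((U : Matrix (Fin N) (Fin N) ℂ) * (S : Matrix (Fin N) (Fin N) ℂ)) ∂(haarProbability (Matrix.unitaryGroup (Fin N) ℂ)) = ∫ U, F (U : Matrix (Fin N) (Fin N) ℂ) ∂(haarProbability (Matrix.unitaryGroup (Fin N) ℂ)) :=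
  integral_mul_right_eq_self (μ := haarProbability (Matrix.unitaryGroup (Fin N) ℂ)) (fun U : Matrix.unitaryGroup (Fin N) ℂ => F (U : Matrix (Fin N) (Fin N) ℂ)) S

/-- **Left invariance, packaged**: for `S ∈ U(N)`, `∫ F(S·U) dU = ∫ F(U) dU`. -/
theorem un_integral_mul_left (F : Matrix (Fin N) (Fin N) ℂ → ℝ) (S : Matrix.unitaryGroup (Fin N) ℂ) :
    ∫ U, F ((S : Matrix (Fin N) (Fin N) ℂ) * (U : Matrix (Fin N) (Fin N) ℂ)) ∂(haarProbability (Matrix.unitaryGroup (Fin N) ℂ)) = ∫ U, F (U : Matrix (Fin N) (Fin N) ℂ) ∂(haarProbability (Matrix.unitaryGroup (Fin N) ℂ)) :=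
  integral_mul_left_eq_self (μ := haarProbability (Matrix.unitaryGroup (Fin N) ℂ)) (fun U : Matrix.unitaryGroup (Fin N) ℂ => F (U : Matrix (Fin N) (Fin N) ℂ)) S

/-- The signed transposition as an element of `U(N)`. -/
theorem sSwapMatrix_mem_unitaryGroup (a b : Fin N) : sSwapMatrix a b ∈ Matrix.unitaryGroup (Fin N) ℂ :=
  Matrix.specialUnitaryGroup_le_unitaryGroup (sSwapMatrix_mem a b)

/-- **Column symmetry of the fourth moment**: `∫ |U_ip|⁴ = ∫ |U_iq|⁴`. -/
theorem un_integral_normSq_sq_entry_eq (i p q : Fin N) :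
    ∫ U, Complex.normSq ((U : Matrix (Fin N) (Fin N) ℂ) i p) ^ 2 ∂(haarProbability (Matrix.unitaryGroup (Fin N) ℂ)) = ∫ U, Complex.normSq ((U : Matrix (Fin N) (Fin N) ℂ) i q) ^ 2 ∂(haarProbability (Matrix.unitaryGroup (Fin N) ℂ)) := by
  by_cases hpq : p = q
  · rw [hpq]
  have h := un_integral_mul_right (fun M : Matrix (Fin N) (Fin N) ℂ => Complex.normSq (M i p) ^ 2)
    ⟨sSwapMatrix p q, sSwapMatrix_mem_unitaryGroup p q⟩
  simp only [(mul_sSwapMatrix_apply _ hpq i).1] at h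
  exact h.symm

/-- **Column symmetry of the mixed moment**: `∫ |U_ip|²|U_iq|² = ∫ |U_ip|²|U_iq′|²` for `q, q′ ≠ p`. -/
theorem un_integral_normSq_mul_normSq_entry_eq (i : Fin N) {p q q' : Fin N} (hq : q ≠ p) (hq' : q' ≠ p) :
    ∫ U, Complex.normSq ((U : Matrix (Fin N) (Fin N) ℂ) i p) * Complex.normSq ((U : Matrix (Fin N) (Fin N) ℂ) i q) ∂(haarProbability (Matrix.unitaryGroup (Fin N) ℂ))
      = ∫ U, Complex.normSq ((U : Matrix (Fin N) (Fin N) ℂ) i p) * Complex.normSq ((U : Matrix (Fin N) (Fin N) ℂ) i q') ∂(haarProbability (Matrix.unitaryGroup (Fin N) ℂ)) := by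
  by_cases hqq : q = q'
  · rw [hqq]
  have h := un_integral_mul_right (fun M : Matrix (Fin N) (Fin N) ℂ => Complex.normSq (M i p) * Complex.normSq (M i q))
    ⟨sSwapMatrix q q', sSwapMatrix_mem_unitaryGroup q q'⟩
  simp only [(mul_sSwapMatrix_apply _ hqq i).1, (mul_sSwapMatrix_apply _ hqq i).2 p hq.symm hq'.symm] at h
  exact h.symm

/-! ### The mixing element `u = ((1+i)/2)·1 + ((1−i)/2)·swap(p,q)` -/

/-- `u u* = 1`: the element `((1+i)/2)·1 + ((1−i)/2)·swap(p,q)` of `U(N)` (it mixes columns `p` and `q` with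
weights of modulus `1/√2`; for `p = q` it is the identity). -/
theorem mixing_swap_mem_unitaryGroup (p q : Fin N) :
    ((1 + I) / 2) • (1 : Matrix (Fin N) (Fin N) ℂ) + ((1 - I) / 2) • Matrix.swap ℂ p q
      ∈ Matrix.unitaryGroup (Fin N) ℂ := by
  rw [Matrix.mem_unitaryGroup_iff, star_add, star_smul, star_smul, star_one, Matrix.star_eq_conjTranspose,
    Matrix.conjTranspose_swap]
  have e1 : (star ((1 + I) / 2) : ℂ) = (1 - I) / 2 := by
    rw [Complex.star_def, map_div₀, map_add, map_one, Complex.conj_I, map_ofNat]; ring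
  have e2 : (star ((1 - I) / 2) : ℂ) = (1 + I) / 2 := by
    rw [Complex.star_def, map_div₀, map_sub, map_one, Complex.conj_I, map_ofNat]; ring
  rw [e1, e2, add_mul, mul_add, mul_add, smul_mul_smul_comm, smul_mul_smul_comm, smul_mul_smul_comm,
    smul_mul_smul_comm, one_mul, one_mul, mul_one, Matrix.swap_mul_self]
  have c1 : (1 + I) / 2 * ((1 - I) / 2) = (1 / 2 : ℂ) := by ring_nf; rw [Complex.I_sq]; ring
  have c2 : (1 + I) / 2 * ((1 + I) / 2) = (I / 2 : ℂ) := by ring_nf; rw [Complex.I_sq]; ring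
  have c3 : (1 - I) / 2 * ((1 - I) / 2) = (-(I / 2) : ℂ) := by ring_nf; rw [Complex.I_sq]; ring
  have c4 : (1 - I) / 2 * ((1 + I) / 2) = (1 / 2 : ℂ) := by ring_nf; rw [Complex.I_sq]; ring
  rw [c1, c2, c3, c4]
  ext a b
  simp only [Matrix.add_apply, Matrix.smul_apply, smul_eq_mul, Matrix.one_apply]
  split_ifs <;> ring

/-- Entries of `U·u` in the mixed columns: `(U u)_{ip} = ((1+i)/2) U_ip + ((1−i)/2) U_iq`. -/
theorem mul_mixing_swap_apply (U : Matrix (Fin N) (Fin N) ℂ) (p q i : Fin N) :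
    (U * (((1 + I) / 2) • (1 : Matrix (Fin N) (Fin N) ℂ) + ((1 - I) / 2) • Matrix.swap ℂ p q)) i p
      = (1 + I) / 2 * U i p + (1 - I) / 2 * U i q := by
  rw [mul_add, Matrix.mul_smul, Matrix.mul_smul, mul_one, Matrix.add_apply, Matrix.smul_apply, Matrix.smul_apply,
    smul_eq_mul, smul_eq_mul, Matrix.mul_swap_apply_left]

/-! ### Right diagonal circles: `U ↦ U · diag(pairFun p q w)` scales column `p` by `w` and column `q` by `w̄` -/

/-- The diagonal circle `diag(pairFun p q w)` as an element of `U(N)`. -/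
theorem diagonal_pairFun_mem_unitaryGroup (p q : Fin N) (w : Circle) :
    Matrix.diagonal (pairFun p q (w : ℂ)) ∈ Matrix.unitaryGroup (Fin N) ℂ :=
  Matrix.specialUnitaryGroup_le_unitaryGroup (diagonal_pairFun_mem p q w)

/-- Values of `pairFun p q w` (`p ≠ q`): `w` at `p`, `w⁻¹` at `q`. -/
theorem pairFun_apply_left_right {p q : Fin N} (hpq : p ≠ q) (w : ℂ) :
    pairFun p q w p = w ∧ pairFun p q w q = w⁻¹ := by
  simp [pairFun, hpq, hpq.symm]

/-- Entries of `U · diag(d)`: `(U·diag d)_{ab} = U_ab · d_b`. -/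
theorem mul_diagonal_apply' (U : Matrix (Fin N) (Fin N) ℂ) (d : Fin N → ℂ) (a b : Fin N) :
    (U * Matrix.diagonal d) a b = U a b * d b := Matrix.mul_diagonal d U a b

/-- For `w ∈ S¹`: `conj (w⁻¹) = w` and `w · conj w = 1` (as complex numbers). -/
theorem circle_conj_inv_coe (w : Circle) : (starRingEnd ℂ) ((w : ℂ)⁻¹) = w ∧ (w : ℂ) * (starRingEnd ℂ) w = 1 := by
  refine ⟨?_, ?_⟩
  · rw [← Circle.coe_inv, Circle.coe_inv_eq_conj, Complex.conj_conj]
  · rw [Complex.mul_conj, Complex.normSq_eq_norm_sq, Circle.norm_coe]; simp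

/-- **Vanishing by a sign flip (right)**: if `F(U·S) = −F(U)` for some `S ∈ U(N)` then `∫ F dU = 0`. -/
theorem un_integral_eq_zero_of_mul_right_eq_neg (F : Matrix (Fin N) (Fin N) ℂ → ℝ) (S : Matrix.unitaryGroup (Fin N) ℂ)
    (h : ∀ U : Matrix.unitaryGroup (Fin N) ℂ, F ((U : Matrix (Fin N) (Fin N) ℂ) * (S : Matrix (Fin N) (Fin N) ℂ)) = -F (U : Matrix (Fin N) (Fin N) ℂ)) :
    ∫ U, F (U : Matrix (Fin N) (Fin N) ℂ) ∂(haarProbability (Matrix.unitaryGroup (Fin N) ℂ)) = 0 := by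
  have key := un_integral_mul_right F S
  simp only [h, integral_neg] at key
  linarith

/-- **Vanishing by a sign flip (left)**: if `F(S·U) = −F(U)` for some `S ∈ U(N)` then `∫ F dU = 0`. -/
theorem un_integral_eq_zero_of_mul_left_eq_neg (F : Matrix (Fin N) (Fin N) ℂ → ℝ) (S : Matrix.unitaryGroup (Fin N) ℂ)
    (h : ∀ U : Matrix.unitaryGroup (Fin N) ℂ, F ((S : Matrix (Fin N) (Fin N) ℂ) * (U : Matrix (Fin N) (Fin N) ℂ)) = -F (U : Matrix (Fin N) (Fin N) ℂ)) :
    ∫ U, F (U : Matrix (Fin N) (Fin N) ℂ) ∂(haarProbability (Matrix.unitaryGroup (Fin N) ℂ)) = 0 := by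
  have key := un_integral_mul_left F S
  simp only [h, integral_neg] at key
  linarith

/-- Pointwise identity behind the first phase kill (`w = i`: `x ↦ x i`, `y ↦ y i⁻¹`). -/
theorem phaseI_sumNormSq_mul_re (x y : ℂ) :
    (Complex.normSq (x * I) + Complex.normSq (y * I⁻¹)) * (I * (x * I) * (starRingEnd ℂ) (y * I⁻¹)).re
      = -((Complex.normSq x + Complex.normSq y) * (I * x * (starRingEnd ℂ) y).re) := by
  rw [Complex.inv_I]
  simp only [map_mul, map_neg, Complex.conj_I, neg_neg, Complex.normSq_neg, Complex.normSq_I, mul_one]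
  have : I * (x * I) * ((starRingEnd ℂ) y * I) = -(I * x * (starRingEnd ℂ) y) := by
    linear_combination (I * x * (starRingEnd ℂ) y) * Complex.I_sq
  rw [this, Complex.neg_re]
  ring

/-- **Phase kill, degree 2 in the phase**: `∫ (|U_ip|² + |U_iq|²)·Re(i·U_ip·conj U_iq) dU = 0` (`p ≠ q`): under the
right circle with `w = i` the integrand changes sign. -/
theorem un_integral_sumNormSq_mul_re_eq_zero (i : Fin N) {p q : Fin N} (hpq : p ≠ q) :
    ∫ U, (Complex.normSq ((U : Matrix (Fin N) (Fin N) ℂ) i p) + Complex.normSq ((U : Matrix (Fin N) (Fin N) ℂ) i q)) * (I * ((U : Matrix (Fin N) (Fin N) ℂ) i p) * (starRingEnd ℂ) ((U : Matrix (Fin N) (Fin N) ℂ) i q)).re ∂(haarProbability (Matrix.unitaryGroup (Fin N) ℂ)) = 0 := by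
  set w : Circle := ⟨I, by simp [Submonoid.unitSphere]⟩ with hwdef
  have hwI : (w : ℂ) = I := rfl
  refine un_integral_eq_zero_of_mul_right_eq_neg (fun M : Matrix (Fin N) (Fin N) ℂ =>
      (Complex.normSq (M i p) + Complex.normSq (M i q)) * (I * M i p * (starRingEnd ℂ) (M i q)).re)
    ⟨Matrix.diagonal (pairFun p q (w : ℂ)), diagonal_pairFun_mem_unitaryGroup p q w⟩ fun U => ?_
  simp only [mul_diagonal_apply', (pairFun_apply_left_right hpq _).1, (pairFun_apply_left_right hpq _).2, hwI]
  exact phaseI_sumNormSq_mul_re _ _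

/-- A circle element `w₈` with `w₈² = i` (namely `e^{iπ/4}`). -/
theorem exists_circle_sq_eq_I : ∃ w : Circle, ((w : ℂ)) ^ 2 = I := by
  refine ⟨Circle.exp (π / 4), ?_⟩
  rw [Circle.coe_exp, sq, ← Complex.exp_add,
    show ((π / 4 : ℝ) : ℂ) * I + ((π / 4 : ℝ) : ℂ) * I = (π / 2 : ℂ) * I by push_cast; ring,
    Complex.exp_mul_I, Complex.cos_pi_div_two, Complex.sin_pi_div_two]
  ring

/-- Pointwise identity behind the second phase kill (`w² = i`: `z = i·x·ȳ ↦ z·w² = i z`, so `Re(z²) ↦ −Re(z²)`). -/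
theorem phase8_re_sq (x y w : ℂ) (hw : w ^ 2 = I) (hcw : (starRingEnd ℂ) w⁻¹ = w) :
    ((I * (x * w) * (starRingEnd ℂ) (y * w⁻¹)) ^ 2).re = -(((I * x * (starRingEnd ℂ) y) ^ 2).re) := by
  rw [map_mul, hcw]
  have h4 : w ^ 4 = -1 := by rw [show w ^ 4 = (w ^ 2) ^ 2 by ring, hw, Complex.I_sq]
  have : (I * (x * w) * ((starRingEnd ℂ) y * w)) ^ 2 = -((I * x * (starRingEnd ℂ) y) ^ 2) := by
    linear_combination ((I * x * (starRingEnd ℂ) y) ^ 2) * h4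
  rw [this, Complex.neg_re]

/-- **Phase kill, degree 4 in the phase**: `∫ Re((i·U_ip·conj U_iq)²) dU = 0` (`p ≠ q`): under the right circle
with `w = e^{iπ/4}` the integrand changes sign. -/
theorem un_integral_re_sq_eq_zero (i : Fin N) {p q : Fin N} (hpq : p ≠ q) :
    ∫ U, ((I * ((U : Matrix (Fin N) (Fin N) ℂ) i p) * (starRingEnd ℂ) ((U : Matrix (Fin N) (Fin N) ℂ) i q)) ^ 2).re ∂(haarProbability (Matrix.unitaryGroup (Fin N) ℂ)) = 0 := by
  obtain ⟨w, hw⟩ := exists_circle_sq_eq_I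
  refine un_integral_eq_zero_of_mul_right_eq_neg (fun M : Matrix (Fin N) (Fin N) ℂ =>
      ((I * M i p * (starRingEnd ℂ) (M i q)) ^ 2).re)
    ⟨Matrix.diagonal (pairFun p q (w : ℂ)), diagonal_pairFun_mem_unitaryGroup p q w⟩ fun U => ?_
  simp only [mul_diagonal_apply', (pairFun_apply_left_right hpq _).1, (pairFun_apply_left_right hpq _).2]
  exact phase8_re_sq _ _ _ hw (circle_conj_inv_coe w).1

/-- The algebra of the mixing step: with `α = (1+i)/2`, `β = (1−i)/2`,
`|αx + βy|⁴ = (|x|⁴ + |y|⁴)/4 + |x|²|y|² + (|x|² + |y|²)·Re(i x ȳ) + Re((i x ȳ)²)/2`. -/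
theorem normSq_mixing_sq (x y : ℂ) :
    Complex.normSq ((1 + I) / 2 * x + (1 - I) / 2 * y) ^ 2
      = (Complex.normSq x ^ 2 + Complex.normSq y ^ 2) / 4 + Complex.normSq x * Complex.normSq y
        + (Complex.normSq x + Complex.normSq y) * (I * x * (starRingEnd ℂ) y).re
        + ((I * x * (starRingEnd ℂ) y) ^ 2).re / 2 := by
  simp only [Complex.normSq_apply, Complex.add_re, Complex.add_im, Complex.mul_re, Complex.mul_im, Complex.div_ofNat_re,
    Complex.div_ofNat_im, Complex.one_re, Complex.one_im, Complex.I_re, Complex.I_im, Complex.sub_re, Complex.sub_im,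
    Complex.conj_re, Complex.conj_im, sq]
  ring

/-- **THE MIXING RELATION**: `∫ |U_ip|⁴ dU = 2 ∫ |U_ip|²|U_iq|² dU` for `p ≠ q` (right multiplication by the mixing
element `u`, the two phase kills, and the column symmetry of the fourth moment). -/
theorem un_integral_normSq_sq_eq_two_mul (i : Fin N) {p q : Fin N} (hpq : p ≠ q) :
    ∫ U, Complex.normSq ((U : Matrix (Fin N) (Fin N) ℂ) i p) ^ 2 ∂(haarProbability (Matrix.unitaryGroup (Fin N) ℂ))
      = 2 * ∫ U, Complex.normSq ((U : Matrix (Fin N) (Fin N) ℂ) i p) * Complex.normSq ((U : Matrix (Fin N) (Fin N) ℂ) i q) ∂(haarProbability (Matrix.unitaryGroup (Fin N) ℂ)) := by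
  set μ := (haarProbability (Matrix.unitaryGroup (Fin N) ℂ)) with hμ
  have key := un_integral_mul_right (fun M : Matrix (Fin N) (Fin N) ℂ => Complex.normSq (M i p) ^ 2)
    ⟨_, mixing_swap_mem_unitaryGroup p q⟩
  simp only [mul_mixing_swap_apply, normSq_mixing_sq] at key
  -- integrability of the pieces
  have c_np : Continuous fun U : Matrix.unitaryGroup (Fin N) ℂ => Complex.normSq ((U : Matrix (Fin N) (Fin N) ℂ) i p) :=
    Complex.continuous_normSq.comp (continuous_UN_entry i p)
  have c_nq : Continuous fun U : Matrix.unitaryGroup (Fin N) ℂ => Complex.normSq ((U : Matrix (Fin N) (Fin N) ℂ) i q) :=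
    Complex.continuous_normSq.comp (continuous_UN_entry i q)
  have c_z : Continuous fun U : Matrix.unitaryGroup (Fin N) ℂ => I * (U : Matrix (Fin N) (Fin N) ℂ) i p * (starRingEnd ℂ) ((U : Matrix (Fin N) (Fin N) ℂ) i q) :=
    (continuous_const.mul (continuous_UN_entry i p)).mul (Complex.continuous_conj.comp (continuous_UN_entry i q))
  have i1 : Integrable (fun U : Matrix.unitaryGroup (Fin N) ℂ => (Complex.normSq ((U : Matrix (Fin N) (Fin N) ℂ) i p) ^ 2 + Complex.normSq ((U : Matrix (Fin N) (Fin N) ℂ) i q) ^ 2) / 4) μ :=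
    integrable_haarUN_of_continuous_real (((c_np.pow 2).add (c_nq.pow 2)).div_const 4)
  have i2 : Integrable (fun U : Matrix.unitaryGroup (Fin N) ℂ => Complex.normSq ((U : Matrix (Fin N) (Fin N) ℂ) i p) * Complex.normSq ((U : Matrix (Fin N) (Fin N) ℂ) i q)) μ :=
    integrable_haarUN_of_continuous_real (c_np.mul c_nq)
  have i3 : Integrable (fun U : Matrix.unitaryGroup (Fin N) ℂ =>
      (Complex.normSq ((U : Matrix (Fin N) (Fin N) ℂ) i p) + Complex.normSq ((U : Matrix (Fin N) (Fin N) ℂ) i q)) * (I * (U : Matrix (Fin N) (Fin N) ℂ) i p * (starRingEnd ℂ) ((U : Matrix (Fin N) (Fin N) ℂ) i q)).re) μ :=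
    integrable_haarUN_of_continuous_real ((c_np.add c_nq).mul (Complex.continuous_re.comp c_z))
  have i4 : Integrable (fun U : Matrix.unitaryGroup (Fin N) ℂ => ((I * (U : Matrix (Fin N) (Fin N) ℂ) i p * (starRingEnd ℂ) ((U : Matrix (Fin N) (Fin N) ℂ) i q)) ^ 2).re / 2) μ :=
    integrable_haarUN_of_continuous_real ((Complex.continuous_re.comp (c_z.pow 2)).div_const 2)
  have ia : Integrable (fun U : Matrix.unitaryGroup (Fin N) ℂ => Complex.normSq ((U : Matrix (Fin N) (Fin N) ℂ) i p) ^ 2) μ :=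
    integrable_haarUN_of_continuous_real (c_np.pow 2)
  have ib : Integrable (fun U : Matrix.unitaryGroup (Fin N) ℂ => Complex.normSq ((U : Matrix (Fin N) (Fin N) ℂ) i q) ^ 2) μ :=
    integrable_haarUN_of_continuous_real (c_nq.pow 2)
  rw [integral_add ((i1.fun_add i2).fun_add i3) i4, integral_add (i1.fun_add i2) i3, integral_add i1 i2, integral_div,
    integral_div, un_integral_sumNormSq_mul_re_eq_zero i hpq, un_integral_re_sq_eq_zero i hpq, integral_add ia ib,
    un_integral_normSq_sq_entry_eq i q p] at key
  linarith

/-! ## §2 The fourth moments of one row: `∫ |U_ip|⁴ = 2/(N(N+1))`, `∫ |U_ip|²|U_iq|² = 1/(N(N+1))` -/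

/-- Row decomposition of the second moment: `∫ |U_ip|² = ∫ |U_ip|⁴ + Σ_{q ≠ p} ∫ |U_ip|²|U_iq|²` (from `Σ_q |U_iq|² = 1`). -/
theorem un_integral_normSq_entry_eq_sum (i p : Fin N) :
    ∫ U, Complex.normSq ((U : Matrix (Fin N) (Fin N) ℂ) i p) ∂(haarProbability (Matrix.unitaryGroup (Fin N) ℂ))
      = ∫ U, Complex.normSq ((U : Matrix (Fin N) (Fin N) ℂ) i p) ^ 2 ∂(haarProbability (Matrix.unitaryGroup (Fin N) ℂ))
        + ∑ q ∈ Finset.univ.erase p, ∫ U, Complex.normSq ((U : Matrix (Fin N) (Fin N) ℂ) i p) * Complex.normSq ((U : Matrix (Fin N) (Fin N) ℂ) i q) ∂(haarProbability (Matrix.unitaryGroup (Fin N) ℂ)) := by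
  have hint : ∀ q : Fin N, Integrable (fun U : Matrix.unitaryGroup (Fin N) ℂ =>
      Complex.normSq ((U : Matrix (Fin N) (Fin N) ℂ) i p) * Complex.normSq ((U : Matrix (Fin N) (Fin N) ℂ) i q)) (haarProbability (Matrix.unitaryGroup (Fin N) ℂ)) := fun q =>
    integrable_haarUN_of_continuous_real ((Complex.continuous_normSq.comp (continuous_UN_entry i p)).mul
      (Complex.continuous_normSq.comp (continuous_UN_entry i q)))
  have h1 : ∫ U, Complex.normSq ((U : Matrix (Fin N) (Fin N) ℂ) i p) ∂(haarProbability (Matrix.unitaryGroup (Fin N) ℂ))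
      = ∫ U, ∑ q, Complex.normSq ((U : Matrix (Fin N) (Fin N) ℂ) i p) * Complex.normSq ((U : Matrix (Fin N) (Fin N) ℂ) i q) ∂(haarProbability (Matrix.unitaryGroup (Fin N) ℂ)) :=
    integral_congr_ae (ae_of_all _ fun U => by beta_reduce; rw [← Finset.mul_sum, sum_normSq_row_UN U i, mul_one])
  rw [h1, integral_finsetSum _ fun q _ => hint q, ← Finset.add_sum_erase _ _ (Finset.mem_univ p)]
  congr 1
  exact integral_congr_ae (ae_of_all _ fun U => by beta_reduce; rw [sq])

/-- **`∫_{U(N)} |U_ip|²·|U_iq|² dU = 1/(N(N+1))`** for `p ≠ q` (`N ≥ 2`). -/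
theorem un_integral_normSq_mul_normSq_entry (hN : 2 ≤ N) (i : Fin N) {p q : Fin N} (hpq : p ≠ q) :
    ∫ U, Complex.normSq ((U : Matrix (Fin N) (Fin N) ℂ) i p) * Complex.normSq ((U : Matrix (Fin N) (Fin N) ℂ) i q) ∂(haarProbability (Matrix.unitaryGroup (Fin N) ℂ)) = 1 / ((N : ℝ) * (N + 1)) := by
  have hsum := un_integral_normSq_entry_eq_sum i p
  rw [un_integral_normSq_entry (by omega) i p, un_integral_normSq_sq_eq_two_mul i hpq,
    Finset.sum_congr rfl fun q hq => un_integral_normSq_mul_normSq_entry_eq i (Finset.ne_of_mem_erase hq) hpq.symm,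
    Finset.sum_const, Finset.card_erase_of_mem (Finset.mem_univ p), Finset.card_univ, Fintype.card_fin, nsmul_eq_mul,
    Nat.cast_sub (by omega : 1 ≤ N), Nat.cast_one] at hsum
  have hN0 : (0 : ℝ) < N := by exact_mod_cast (show 0 < N by omega)
  field_simp
  field_simp at hsum
  linarith

/-- **`∫_{U(N)} |U_ip|⁴ dU = 2/(N(N+1))`** (`N ≥ 2`): the fourth moment of a single entry of a Haar unitary. -/
theorem un_integral_normSq_sq_entry (hN : 2 ≤ N) (i p : Fin N) :
    ∫ U, Complex.normSq ((U : Matrix (Fin N) (Fin N) ℂ) i p) ^ 2 ∂(haarProbability (Matrix.unitaryGroup (Fin N) ℂ)) = 2 / ((N : ℝ) * (N + 1)) := by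
  haveI : Nontrivial (Fin N) := Fin.nontrivial_iff_two_le.mpr hN
  obtain ⟨q, hq⟩ := exists_ne p
  rw [un_integral_normSq_sq_eq_two_mul i (Ne.symm hq), un_integral_normSq_mul_normSq_entry hN i (Ne.symm hq)]
  ring

/-! ## §3 Two diagonal entries: `∫ |U_ii|²|U_jj|² = 1/(N² − 1)` -/

/-- **Columns of a unitary matrix have unit norm**: `Σ_m |U_mj|² = 1` on `U(N)`. -/
theorem sum_normSq_col_UN (U : Matrix.unitaryGroup (Fin N) ℂ) (j : Fin N) :
    ∑ m, Complex.normSq ((U : Matrix (Fin N) (Fin N) ℂ) m j) = 1 := by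
  have hU : star (U : Matrix (Fin N) (Fin N) ℂ) * (U : Matrix (Fin N) (Fin N) ℂ) = 1 := Matrix.mem_unitaryGroup_iff'.mp U.2
  have h := congrFun (congrFun hU j) j
  rw [Matrix.mul_apply, Matrix.one_apply_eq] at h
  have h' : ∑ m, ((Complex.normSq ((U : Matrix (Fin N) (Fin N) ℂ) m j) : ℝ) : ℂ) = 1 := by
    rw [← h]
    refine Finset.sum_congr rfl fun m _ => ?_
    rw [Matrix.star_apply, Complex.star_def, Complex.normSq_eq_conj_mul_self]
  exact_mod_cast h'

/-- Left signed transpositions equalise `∫ |U_ii|²|U_mj|²` over `m ≠ i`: for `m ∉ {i, j}`,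
`∫ |U_ii|²|U_mj|² = ∫ |U_ii|²|U_jj|²`. -/
theorem un_integral_normSq_diag_mul_normSq_eq {i j m : Fin N} (hmi : m ≠ i) (hmj : m ≠ j) (hij : i ≠ j) :
    ∫ U, Complex.normSq ((U : Matrix (Fin N) (Fin N) ℂ) i i) * Complex.normSq ((U : Matrix (Fin N) (Fin N) ℂ) m j) ∂(haarProbability (Matrix.unitaryGroup (Fin N) ℂ))
      = ∫ U, Complex.normSq ((U : Matrix (Fin N) (Fin N) ℂ) i i) * Complex.normSq ((U : Matrix (Fin N) (Fin N) ℂ) j j) ∂(haarProbability (Matrix.unitaryGroup (Fin N) ℂ)) := by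
  have h := un_integral_mul_left (fun M : Matrix (Fin N) (Fin N) ℂ => Complex.normSq (M i i) * Complex.normSq (M j j))
    ⟨sSwapMatrix m j, sSwapMatrix_mem_unitaryGroup m j⟩
  simp only [(sSwapMatrix_mul_apply _ hmj j).1, (sSwapMatrix_mul_apply _ hmj i).2 i hmi.symm hij] at h
  exact h

/-- Column decomposition: `∫ |U_ii|² = ∫ |U_ii|²|U_ij|² + Σ_{m ≠ i} ∫ |U_ii|²|U_mj|²` (from `Σ_m |U_mj|² = 1`). -/
theorem un_integral_normSq_diag_eq_sum (i j : Fin N) :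
    ∫ U, Complex.normSq ((U : Matrix (Fin N) (Fin N) ℂ) i i) ∂(haarProbability (Matrix.unitaryGroup (Fin N) ℂ))
      = ∫ U, Complex.normSq ((U : Matrix (Fin N) (Fin N) ℂ) i i) * Complex.normSq ((U : Matrix (Fin N) (Fin N) ℂ) i j) ∂(haarProbability (Matrix.unitaryGroup (Fin N) ℂ))
        + ∑ m ∈ Finset.univ.erase i, ∫ U, Complex.normSq ((U : Matrix (Fin N) (Fin N) ℂ) i i) * Complex.normSq ((U : Matrix (Fin N) (Fin N) ℂ) m j) ∂(haarProbability (Matrix.unitaryGroup (Fin N) ℂ)) := by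
  have hint : ∀ m : Fin N, Integrable (fun U : Matrix.unitaryGroup (Fin N) ℂ =>
      Complex.normSq ((U : Matrix (Fin N) (Fin N) ℂ) i i) * Complex.normSq ((U : Matrix (Fin N) (Fin N) ℂ) m j)) (haarProbability (Matrix.unitaryGroup (Fin N) ℂ)) := fun m =>
    integrable_haarUN_of_continuous_real ((Complex.continuous_normSq.comp (continuous_UN_entry i i)).mul
      (Complex.continuous_normSq.comp (continuous_UN_entry m j)))
  have h1 : ∫ U, Complex.normSq ((U : Matrix (Fin N) (Fin N) ℂ) i i) ∂(haarProbability (Matrix.unitaryGroup (Fin N) ℂ))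
      = ∫ U, ∑ m, Complex.normSq ((U : Matrix (Fin N) (Fin N) ℂ) i i) * Complex.normSq ((U : Matrix (Fin N) (Fin N) ℂ) m j) ∂(haarProbability (Matrix.unitaryGroup (Fin N) ℂ)) :=
    integral_congr_ae (ae_of_all _ fun U => by beta_reduce; rw [← Finset.mul_sum, sum_normSq_col_UN U j, mul_one])
  rw [h1, integral_finsetSum _ fun m _ => hint m, ← Finset.add_sum_erase _ _ (Finset.mem_univ i)]

/-- **`∫_{U(N)} |U_ii|²·|U_jj|² dU = 1/(N² − 1)`** for `i ≠ j` (`N ≥ 2`): two different rows AND columns. -/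
theorem un_integral_normSq_diag_mul_normSq_diag (hN : 2 ≤ N) {i j : Fin N} (hij : i ≠ j) :
    ∫ U, Complex.normSq ((U : Matrix (Fin N) (Fin N) ℂ) i i) * Complex.normSq ((U : Matrix (Fin N) (Fin N) ℂ) j j) ∂(haarProbability (Matrix.unitaryGroup (Fin N) ℂ)) = 1 / ((N : ℝ) ^ 2 - 1) := by
  have hsum := un_integral_normSq_diag_eq_sum i j
  have hterm : ∀ m ∈ Finset.univ.erase i,
      ∫ U, Complex.normSq ((U : Matrix (Fin N) (Fin N) ℂ) i i) * Complex.normSq ((U : Matrix (Fin N) (Fin N) ℂ) m j) ∂(haarProbability (Matrix.unitaryGroup (Fin N) ℂ))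
        = ∫ U, Complex.normSq ((U : Matrix (Fin N) (Fin N) ℂ) i i) * Complex.normSq ((U : Matrix (Fin N) (Fin N) ℂ) j j) ∂(haarProbability (Matrix.unitaryGroup (Fin N) ℂ)) := fun m hm => by
    by_cases hmj : m = j
    · rw [hmj]
    · exact un_integral_normSq_diag_mul_normSq_eq (Finset.ne_of_mem_erase hm) hmj hij
  rw [un_integral_normSq_entry (by omega) i i, un_integral_normSq_mul_normSq_entry hN i hij, Finset.sum_congr rfl hterm,
    Finset.sum_const, Finset.card_erase_of_mem (Finset.mem_univ i), Finset.card_univ, Fintype.card_fin, nsmul_eq_mul,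
    Nat.cast_sub (by omega : 1 ≤ N), Nat.cast_one] at hsum
  have hN1 : (1 : ℝ) < N := by exact_mod_cast (show 1 < N by omega)
  have hA : (N : ℝ) ^ 2 - 1 ≠ 0 := by nlinarith
  have hB : (N : ℝ) - 1 ≠ 0 := by linarith
  field_simp
  field_simp at hsum
  nlinarith [hsum]

end Summit.Ventures.LatticeQCDFlow.Scoring
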